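import Literature.IUT.LogThetaLattice.GlobalLGPFrobenioidsModFrak
import HarnessLib

/-!
# [IUTchIII] Proposition 3.7 (ii), stack-theoretic version: `(†𝓕⊛_𝔪𝔬𝔡)_α` with the ramification weights `e(v̲|v)`
# (repair-of-record companion of `GlobalLGPFrobenioidsModFrak.lean`, audit finding d011-F1)

abc-iut cell, layer L6, D-0067 wave-4 discharge seat abc-iut-w4-d005 (board row F10-a = [IUTchIII] Prop. 3.7 (i)(ii);
node IUTchIII:Prop3.7(ii)); written in answer to the RQ7 audit of abc-iut-w5-d011 (HOME/staging/w5/w5-d011/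
AUDIT-p412491.md, finding d011-F1, MEDIUM, modelling). S. Mochizuki, *Inter-universal Teichmüller Theory III*, kurims
manuscript (May 2020), Example 3.6 (i)(ii) p. 107, Remark 3.6.1 p. 108, Proposition 3.7 (ii) p. 110; *Inter-universal
Teichmüller Theory I*, Remark 3.1.5 (kurims pp. 65–66) [claim key Mochizuki2012, status disputed (D-0012)]; [FrdI]
Example 6.3 [cite: MochizukiFrdI2008, Ex. 6.3 p.113].

THE FINDING. `GlobalLGPFrobenioidsModFrak.lean` §2–§4 instantiate abc-iut-L6-t6's abstract Example-3.6 datum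
`(Γ_v ⊇ Γ_v^{≥0}, β_v)` with `β_v = ord_v` OF THE NUMBER FIELD `F = (†𝕄⊛_𝔪𝔬𝔡)_α ≅ F_mod` ITSELF — that is the NON-stack-theoretic
[FrdI] Ex. 6.3 Frobenioid of `F`. Print's datum is finer: the places are `v̲ ∈ 𝕍 ⊂ 𝕍(K)` for the extension `K ⊋ F_mod`
([IUTchI] Def. 3.1 (e), `𝕍 ⥲ 𝕍_mod`), the fractional ideals are `𝒪_{K_v̲}`-modules and "`β_v : F^×_mod → K^×_v/𝒪^×_{K_v}`"
([IUTchIII] Ex. 3.6 (i) p. 107) is the valuation of `K_v̲` restricted to `F_mod`, i.e. `e(v̲|v)·ord_v` with the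
ramification index `e(v̲|v)` — whence Remark 3.6.1's "subquotients of the PERFECTION `(F^×_mod)^{pf}`" and [IUTchI]
Rmk. 3.1.5's "stack-theoretic version of [FrdI], Example 6.3" (`S_mod := Spec(𝒪_K)//Gal(K/F_mod)`), which "upon passing
to either the perfection or the realification … become[s] naturally isomorphic to the non-stack-theoretic
version". At a ramified `v̲` the two categories differ (objects `𝔪_{K_v̲}^m` with `e(v̲|v) ∤ m` have no integral preimage).

THIS FILE types the STACK-THEORETIC version over the same value groups `Prop37.Gamma` / cones `Prop37.nonneg`,
parametrised by weights `e : Places F → ℕ+` (to be instantiated by `e(v̲|v)`, `= 1` at archimedean places in the tree's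
unsquared-absolute-value convention): `Prop37.betaE F e := e • beta` (`betaE_one`: `e = 1` recovers §2), the standing
hypotheses `Prop37.modelHypsE` (same proof: the cone clauses do not involve `β`, finite support survives nonzero weights),
print's `(†𝓕⊛_𝔪𝔬𝔡)_α` as `Prop37.FfrakE F e := FrakCat …`, `(†𝓕⊛_mod)_α` in model form `Prop37.FmodModelE`, the natural
isomorphism `Prop37.isoFrakModE : FfrakE F e ≌ FmodModelE F e` (abc-iut-L6-t6's `toModel`, an equivalence unconditionally)
with its rational-function clause `Prop37.unit_toModel_mapE`, and the divisor dictionary for the weighted principal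
family (`frakObjEquiv_betaDivE_fst/_snd`: coordinates `e_w·ord_w(f)`, `e_v·(−log|f|_v)`). Nothing here takes a side on
[IUTchIII] Cor. 3.12; typed ≠ discharged; instantiated ≠ endorsed.
-/

noncomputable section

namespace Literature.IUT.LogThetaLattice

namespace Prop37

open CategoryTheory NumberField GlobalFrobenioidModels
open Literature.AlgebraicGeometry.Frobenioids (Places ordFin)

variable (F : Type) [Field F] [NumberField F] (e : Places F → ℕ+)

/-- **Print's `β_v`** ([IUTchIII] Ex. 3.6 (i) p. 107: "`β_v : F^×_mod → K^×_v/𝒪^×_{K_v}`" for `v̲ ∈ 𝕍 ⊂ 𝕍(K)`, `K ⊋ F_mod`;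
[IUTchI] Rmk. 3.1.5, stack-theoretic version): on `F_mod` the valuation of `K_v̲` is `e(v̲|v)·ord_v`, so the class of
`f ∈ F^×_mod` in `Γ_v̲ = K^×_v̲/𝒪^×_{K_v̲} ≅ ℤ` (resp. `ℝ`) is `e_v • β_v(f)` — the datum of `GlobalLGPFrobenioidsModFrak` §2
weighted by `e : 𝕍 → ℕ_{≥1}` (a PARAMETER, to be instantiated from [IUTchI] Def. 3.1 (e)'s `𝕍 ⥲ 𝕍_mod`).
[claim: Mochizuki2012, status: disputed] -/
def betaE : ∀ p : Places F, Additive Fˣ →+ Gamma F p := fun p => (e p : ℕ) • beta F p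

/-- `β^e_v(f) = e_v • β_v(f)`. [claim: Mochizuki2012, status: disputed] -/
@[simp] theorem betaE_apply (p : Places F) (f : Additive Fˣ) : betaE F e p f = (e p : ℕ) • beta F p f := rfl

/-- With all weights `1` the stack-theoretic datum IS the datum of `GlobalLGPFrobenioidsModFrak` §2.
[claim: Mochizuki2012, status: disputed] -/
theorem betaE_one : betaE F (fun _ => 1) = beta F := by
  funext p
  refine AddMonoidHom.ext fun f => ?_
  rw [betaE_apply, PNat.one_coe, one_nsmul]

/-- `β^e_v(f) = 0` for all but finitely many `v` (the weights are nonzero naturals, so the support is that of `β`).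
[claim: Mochizuki2012, status: disputed] -/
theorem finite_betaE_ne_zero (f : Fˣ) : {p : Places F | betaE F e p (Additive.ofMul f) ≠ 0}.Finite := by
  refine (finite_beta_ne_zero F f).subset fun p hp => ?_
  intro h0
  exact hp (by rw [betaE_apply, h0, nsmul_zero])

/-- **`ModelHyps` for the stack-theoretic datum** (the cone properties do not involve `β`; finite support survives the
weights). [claim: Mochizuki2012, status: disputed] -/
theorem modelHypsE : ModelHyps (F := F) (V := Places F) (Γ := Gamma F) (nonneg F) (betaE F e) where
  directed := (modelHyps F).directed
  saturated := (modelHyps F).saturated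
  sharp := (modelHyps F).sharp
  finite f := finite_betaE_ne_zero F e f

/-- **Print's `(†𝓕⊛_𝔪𝔬𝔡)_α`, stack-theoretic version** ([IUTchIII] Prop. 3.7 (ii) p. 110; [IUTchI] Rmk. 3.1.5): the
category `𝓕⊛_𝔪𝔬𝔡` of Example 3.6 (ii) on the weighted datum — objects `{𝔍_v̲ = 𝔪_{K_v̲}^{m_v̲}}` (classes `m_v̲ ∈ ℤ` at finite,
`∈ ℝ` at archimedean `v̲`), morphisms `(n, f)` with `e_v̲·ord_v(f) + n·m_{1,v̲} − m_{2,v̲} ≥ 0`. For `e = 1` this is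
`Prop37.Ffrak F` (`betaE_one`). [claim: Mochizuki2012, status: disputed] -/
abbrev FfrakE : Type := FrakCat F (Places F) (Gamma F) (nonneg F) (betaE F e)

/-- `(†𝓕⊛_mod)_α` (stack-theoretic, [IUTchI] Rmk. 3.1.5) in [FrdI] Thm. 5.2 model form: the model Frobenioid of the
weighted datum. [claim: Mochizuki2012, status: disputed] -/
abbrev FmodModelE : Type := FrakModel (modelHypsE F e)

/-- **[IUTchIII] Prop. 3.7 (ii), first isomorphism, stack-theoretic version**: `toModel : (†𝓕⊛_𝔪𝔬𝔡)_α ⥤ (†𝓕⊛_mod)_α` is an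
equivalence for the weighted datum, unconditionally. [claim: Mochizuki2012, status: disputed] -/
theorem toModel_isEquivalenceE :
    (toModel (F := F) (V := Places F) (Γ := Gamma F) (nonneg := nonneg F) (β := betaE F e)
      (modelHypsE F e)).IsEquivalence :=
  GlobalFrobenioidModels.toModel_isEquivalence (modelHypsE F e)

/-- The natural isomorphism `(†𝓕⊛_𝔪𝔬𝔡)_α ≌ (†𝓕⊛_mod)_α`, stack-theoretic version. [claim: Mochizuki2012, status: disputed] -/
def isoFrakModE : FfrakE F e ≌ FmodModelE F e :=
  haveI := toModel_isEquivalenceE F e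
  (toModel (nonneg := nonneg F) (β := betaE F e) (modelHypsE F e)).asEquivalence

/-- The functor of `isoFrakModE` is abc-iut-L6-t6's `toModel`. [claim: Mochizuki2012, status: disputed] -/
theorem isoFrakModE_functor :
    (isoFrakModE F e).functor = toModel (nonneg := nonneg F) (β := betaE F e) (modelHypsE F e) := rfl

/-- **[IUTchIII] Prop. 3.7 (ii), rational-function clause, stack-theoretic version**: every morphism `(n, f)` goes to
the model morphism with unit component `f`. [claim: Mochizuki2012, status: disputed] -/
theorem unit_toModel_mapE {X Y : FfrakE F e} (φ : X ⟶ Y) :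
    Literature.AlgebraicGeometry.Frobenioids.ModelFrobenioid.unit ((isoFrakModE F e).functor.map φ) =
      FrakCat.fn φ :=
  GlobalFrobenioidModels.unit_toModel_map _ φ

/-- The divisor dictionary for the weighted principal family at the finite places: `(β^e_v(f))_v ↦ (e_w·ord_w(f))_w`
(integral coordinates of the stack-theoretic principal divisor, whose `(1/e)`-rescaling / realification is [FrdI]
Ex. 6.3's `div(f)`, [IUTchI] Rmk. 3.1.5). [claim: Mochizuki2012, status: disputed] -/
theorem frakObjEquiv_betaDivE_fst (f : Fˣ) (w : FinitePlace F) :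
    (frakObjEquiv F (Multiplicative.toAdd (betaDiv (modelHypsE F e) f))).1 w =
      (e (.inr w) : ℕ) * ordFin F w f := by
  rw [frakObjEquiv_fst, cls_betaDiv, betaE_apply, beta_inr, nsmul_eq_mul]

/-- … and at the archimedean places: `↦ (e_v·(−log|f|_v))_v`. [claim: Mochizuki2012, status: disputed] -/
theorem frakObjEquiv_betaDivE_snd (f : Fˣ) (v : InfinitePlace F) :
    (frakObjEquiv F (Multiplicative.toAdd (betaDiv (modelHypsE F e) f))).2 v =
      (e (.inl v) : ℕ) * (-Real.log (v (f : F))) := by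
  rw [frakObjEquiv_snd, cls_betaDiv, betaE_apply, beta_inl, nsmul_eq_mul]

end Prop37

end Literature.IUT.LogThetaLattice

end
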